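import Mathlib
import HarnessLib
import Summits.HubbardSuperconductivity.HubbardSuperconductivity.Theorems.KLProgrammeKLRegimeEngineV17F2ClosersVGQDoors

/-!
# K3 ENGINE (stmt-HubbardSuperconductivity-20437 `KLRegimeEngineV17F2`, V2 registration 27cd7ed0f55f17c0), row (c) `stub_engine_step_values`:
# the three remaining SHARE rows `hShareHd`, `hShareRL`, `hShareEps` of the (c)-OUT package from CURRENCY rows (sufficient forms, producer's choice)
# (cell gate-hubbard-kl, seat hubbard-kl-k3c2-p2 g25; companion of `…ClosersVGQSizeFits` p717608)

WHY.  After `…ClosersVGQSizeFits` / `…ClosersVGQOutD` the (c)-OUT package (γ: `rowC_hexOut_of_pkgγ`, δ: `rowC_hexOut_of_pkgδ`) keeps three SHARE rows whose left sides are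
producer data in unknown currency: `hShareHd` (`(Λₙ − Λₙ₊₁)·RH/2 ≤ ¼·cloc·(Klam U)²·4^{−θn}`, the `Hd` cross-line row), `hShareRL` (`RL ≤ ¼·Q.CL β n/L`, the finite-volume
`LOC` row) and `hShareEps` (`2(ε₁·2048·15367 + A₂·4096·15381·(ρw/π + 1/L)) + 2εS·2048·15367 ≤ ¼·cloc(Klam U)²4^{−θn} + ¼·Q.CR(Klam|U|)³2⁻ⁿ`, the flatness / window
entries of the dressed split and of the self-energy insertion).  They stay ROWS of the package (the producer — E1 / k3c1 — picks its currency), but each has an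
elementary SUFFICIENT currency form at the registered tokens (`klEngGeo11.cloc = 2¹⁰`, `θ = ½` ⇒ slot `256·(Klam U)²·2⁻ⁿ`; floors `2⁶⁰(β²+1)4ⁿ ≤ Q.CL β n`, `2⁶⁰ ≤ Q.CR`
at `Q = klEngQ9dG klEngGeo14 P R`), proved here once so that a producer meeting it discharges the row by ONE call:
* **`rowC_shareHd_of_currency`** — `RH ≤ 2¹⁴·(Klam U)²·2ⁿ` ⇒ `hShareHd` (`Λₙ − Λₙ₊₁ = (3/128)·4⁻ⁿ`);
* **`rowC_shareRL_of_currency`** — `RL ≤ 2⁵⁸·(β²+1)·4ⁿ/L` ⇒ `hShareRL`;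
* **`rowC_shareEps_of_currency`** — the CUBIC, `2⁻ⁿ`-decaying forms `ε₁ ≤ 2³⁰(Klam U)³2⁻ⁿ`, `εS ≤ 2³⁰(Klam U)³2⁻ⁿ`, `A₂·(ρw/π + 1/L) ≤ 2²⁹(Klam U)³2⁻ⁿ` ⇒ `hShareEps`
  (booked entirely in the `CR` part; the natural flatness `ℓ·X·Λₙ₊₁` of band-scale-Lipschitz data decays like `4⁻ⁿ`, and «FLAT-CUBIC» (AMENDMENT 25) makes `X` cubic);
* generic-real cores `shareHd_arith`, `shareEps_arith`.
Pure real arithmetic between package numerals; nothing here asserts any row of the package, (c), K3 or superconductivity.  0 kit · 0 lit.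
-/

namespace Summit.HubbardSuperconductivity.HubbardSuperconductivity.Theorems.EngineV8

set_option linter.dupNamespace false -- summit = problem name (single-conjunct summit), D-0017

noncomputable section

open Real Finset Literature.MathematicalPhysics.QuantumLattice Literature.MathematicalPhysics.QuantumLattice.BandSectorCounting
open Summit.HubbardSuperconductivity.HubbardSuperconductivity.Theorems.KLProgrammeLegKernels
open Summit.HubbardSuperconductivity.HubbardSuperconductivity.Theorems.KLRegimeSplit

/-! ## §1 Generic-real cores -/

/-- `Hd`-share arithmetic: `(e₀(4ⁿ)⁻¹ − e₀(4ⁿ⁺¹)⁻¹)·(RH/2) ≤ ¼·(cloc·K2·(2ⁿ)⁻¹)` for `RH ≤ 2¹⁴·K2·2ⁿ`, `e₀ = 1/32`, `2¹⁰ ≤ cloc`. -/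
theorem shareHd_arith {K2 RH cloc : ℝ} (n : ℕ) (hK2 : 0 ≤ K2) (hcloc : 2 ^ 10 ≤ cloc) (hRH : RH ≤ 2 ^ 14 * K2 * 2 ^ n) :
    (1 / 32 * ((4 : ℝ) ^ n)⁻¹ - 1 / 32 * ((4 : ℝ) ^ (n + 1))⁻¹) * (2⁻¹ * RH) ≤ 4⁻¹ * (cloc * K2 * ((2 : ℝ) ^ n)⁻¹) := by
  have h2 : (0 : ℝ) < 2 ^ n := by positivity
  have h4 : (4 : ℝ) ^ n = 2 ^ n * 2 ^ n := by rw [← mul_pow]; norm_num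
  have hfac : 1 / 32 * ((4 : ℝ) ^ n)⁻¹ - 1 / 32 * ((4 : ℝ) ^ (n + 1))⁻¹ = 3 / 128 * ((2 : ℝ) ^ n)⁻¹ * ((2 : ℝ) ^ n)⁻¹ := by
    rw [pow_succ, h4]; field_simp; ring
  rw [hfac]
  have hi : 0 < ((2 : ℝ) ^ n)⁻¹ := by positivity
  have hRH' : ((2 : ℝ) ^ n)⁻¹ * RH ≤ 2 ^ 14 * K2 := by
    calc ((2 : ℝ) ^ n)⁻¹ * RH ≤ ((2 : ℝ) ^ n)⁻¹ * (2 ^ 14 * K2 * 2 ^ n) := mul_le_mul_of_nonneg_left hRH hi.le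
      _ = 2 ^ 14 * K2 := by field_simp
  have hcl : 2 ^ 10 * K2 * ((2 : ℝ) ^ n)⁻¹ ≤ cloc * K2 * ((2 : ℝ) ^ n)⁻¹ :=
    mul_le_mul_of_nonneg_right (mul_le_mul_of_nonneg_right hcloc hK2) hi.le
  have : 3 / 128 * ((2 : ℝ) ^ n)⁻¹ * ((2 : ℝ) ^ n)⁻¹ * (2⁻¹ * RH) = 3 / 256 * ((2 : ℝ) ^ n)⁻¹ * (((2 : ℝ) ^ n)⁻¹ * RH) := by ring
  rw [this]
  nlinarith [mul_le_mul_of_nonneg_left hRH' (show (0 : ℝ) ≤ 3 / 256 * ((2 : ℝ) ^ n)⁻¹ by positivity)]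

/-- `ε`-share arithmetic in the cubic slot: `2(ε₁·a + W·b) + 2εS·a ≤ ¼·CR·K3·D` for `ε₁, εS ≤ 2³⁰K3·D`, `W ≤ 2²⁹K3·D`, `a ≤ 2²⁵`, `b ≤ 2²⁶`, `2⁶⁰ ≤ CR`. -/
theorem shareEps_arith {ε₁ εS W a b K3 D CR slot : ℝ} (hK3 : 0 ≤ K3) (hD : 0 ≤ D) (ha0 : 0 ≤ a) (ha : a ≤ 2 ^ 25) (hb0 : 0 ≤ b) (hb : b ≤ 2 ^ 26)
    (hε₁ : ε₁ ≤ 2 ^ 30 * K3 * D) (hεS : εS ≤ 2 ^ 30 * K3 * D) (hW : W ≤ 2 ^ 29 * K3 * D) (hCR : 2 ^ 60 ≤ CR) (hslot : 0 ≤ slot) :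
    2 * (ε₁ * a + W * b) + 2 * (εS * a) ≤ 4⁻¹ * slot + 4⁻¹ * (CR * K3 * D) := by
  have hKD : 0 ≤ K3 * D := mul_nonneg hK3 hD
  have h1 : ε₁ * a ≤ 2 ^ 30 * K3 * D * 2 ^ 25 := by nlinarith
  have h2 : εS * a ≤ 2 ^ 30 * K3 * D * 2 ^ 25 := by nlinarith
  have h3 : W * b ≤ 2 ^ 29 * K3 * D * 2 ^ 26 := by nlinarith
  have h4 : 2 ^ 60 * (K3 * D) ≤ CR * (K3 * D) := mul_le_mul_of_nonneg_right hCR hKD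
  nlinarith

/-! ## §2 The three share rows at the registered tokens, `s = ¼`, `Q = klEngQ9dG klEngGeo14 P R` -/

variable {P : SplitConsts} {R : RenConsts} {U : ℝ}

/-- **`hShareHd` FROM A CURRENCY ROW**: `RH ≤ 2¹⁴·(Klam U)²·2ⁿ` gives `(Λₙ − Λₙ₊₁)·(RH/2) ≤ ¼·(klEngGeo11.cloc·(Klam U)²·4^{−(klEngGeo11.θ·n)})`
(the literal `hShareHd` of `rowC_hexOut_of_pkgγ/δ`; `cloc = 2¹⁰`, `θ = ½`). -/
theorem rowC_shareHd_of_currency (U : ℝ) (n : ℕ) {RH : ℝ} (hRH : RH ≤ 2 ^ 14 * (P.Klam * U) ^ 2 * 2 ^ n) :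
    (klScale klE0 n - klScale klE0 (n + 1)) * (2⁻¹ * RH) ≤ 4⁻¹ * (klEngGeo11.cloc * (P.Klam * U) ^ 2 * (4 : ℝ) ^ (-(klEngGeo11.θ * n))) := by
  rw [cloc_slot_eq_of_half klEngGeo11_θ_eq]
  unfold klScale
  rw [klE0]
  exact shareHd_arith n (sq_nonneg _) (le_of_eq klEngGeo11_cloc_eq.symm) hRH

/-- **`hShareRL` FROM A CURRENCY ROW**: `RL ≤ 2⁵⁸·(β²+1)·4ⁿ/L` gives `RL ≤ ¼·((klEngQ9dG klEngGeo14 P R).CL β n / L)` (floor `2⁶⁰Psq²Rsq²(β²+1)4ⁿ ≤ CL β n`). -/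
theorem rowC_shareRL_of_currency (P : SplitConsts) (R : RenConsts) (β : ℝ) {L : ℕ} (n : ℕ) {RL : ℝ}
    (hRL : RL ≤ 2 ^ 58 * (β ^ 2 + 1) * (4 : ℝ) ^ n / L) :
    RL ≤ 4⁻¹ * ((klEngQ9dG klEngGeo14 P R).CL β n / L) := by
  have hP1 : 1 ≤ klEngPsq P := one_le_klEngPsq P
  have hR1 : 1 ≤ klEngRsq R := one_le_klEngRsq R
  have hPR : 1 ≤ klEngPsq P ^ 2 * klEngRsq R ^ 2 := one_le_mul_of_one_le_of_one_le (one_le_pow₀ hP1) (one_le_pow₀ hR1)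
  have hfl := rowC_hQCL klEngGeo14 P R β n
  have hCL : 2 ^ 60 * (β ^ 2 + 1) * (4 : ℝ) ^ n ≤ (klEngQ9dG klEngGeo14 P R).CL β n := by
    refine le_trans ?_ hfl
    have h0 : 0 ≤ 2 ^ 60 * (β ^ 2 + 1) * (4 : ℝ) ^ n := by positivity
    calc 2 ^ 60 * (β ^ 2 + 1) * (4 : ℝ) ^ n ≤ 2 ^ 60 * (β ^ 2 + 1) * (4 : ℝ) ^ n * (klEngPsq P ^ 2 * klEngRsq R ^ 2) :=
          le_mul_of_one_le_right h0 hPR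
      _ = 2 ^ 60 * klEngPsq P ^ 2 * klEngRsq R ^ 2 * (β ^ 2 + 1) * (4 : ℝ) ^ n := by ring
  have hL0 : (0 : ℝ) ≤ (L : ℝ) := Nat.cast_nonneg L
  calc RL ≤ 2 ^ 58 * (β ^ 2 + 1) * (4 : ℝ) ^ n / L := hRL
    _ = 4⁻¹ * (2 ^ 60 * (β ^ 2 + 1) * (4 : ℝ) ^ n / L) := by ring
    _ ≤ 4⁻¹ * ((klEngQ9dG klEngGeo14 P R).CL β n / L) := by
        exact mul_le_mul_of_nonneg_left (div_le_div_of_nonneg_right hCL hL0) (by norm_num)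

/-- **`hShareEps` FROM THREE CUBIC CURRENCY ROWS**: `ε₁ ≤ 2³⁰(Klam U)³2⁻ⁿ`, `εS ≤ 2³⁰(Klam U)³2⁻ⁿ`, `A₂·(ρw/π + 1/L) ≤ 2²⁹(Klam U)³2⁻ⁿ` (`0 < U`) give the literal
`hShareEps` of `rowC_hexOut_of_pkgγ/δ` at `s = ¼`, `Q = klEngQ9dG klEngGeo14 P R` — booked entirely in the `CR`-part of the slot (`2⁶⁰ ≤ Q.CR`). -/
theorem rowC_shareEps_of_currency (P : SplitConsts) (R : RenConsts) (hU : 0 < U) {L : ℕ} (n : ℕ) {ε₁ εS A₂ ρw : ℝ}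
    (hε₁ : ε₁ ≤ 2 ^ 30 * (P.Klam * U) ^ 3 * ((2 : ℝ) ^ n)⁻¹) (hεS : εS ≤ 2 ^ 30 * (P.Klam * U) ^ 3 * ((2 : ℝ) ^ n)⁻¹)
    (hW : A₂ * (ρw / π + ((L : ℝ))⁻¹) ≤ 2 ^ 29 * (P.Klam * U) ^ 3 * ((2 : ℝ) ^ n)⁻¹) (hKU : 0 ≤ P.Klam * U) :
    2 * ((ε₁ * (2048 * 15367) + A₂ * (4096 * 15381) * (ρw / π + ((L : ℝ))⁻¹))) + 2 * (εS * (2048 * 15367)) ≤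
      4⁻¹ * (klEngGeo11.cloc * (P.Klam * U) ^ 2 * (4 : ℝ) ^ (-(klEngGeo11.θ * n))) +
        4⁻¹ * ((klEngQ9dG klEngGeo14 P R).CR * (P.Klam * |U|) ^ 3 * ((2 : ℝ) ^ n)⁻¹) := by
  rw [abs_of_pos hU]
  have hP1 : 1 ≤ klEngPsq P := one_le_klEngPsq P
  have hR1 : 1 ≤ klEngRsq R := one_le_klEngRsq R
  have hPR : 1 ≤ klEngPsq P ^ 2 * klEngRsq R ^ 2 := one_le_mul_of_one_le_of_one_le (one_le_pow₀ hP1) (one_le_pow₀ hR1)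
  have hCR : 2 ^ 60 ≤ (klEngQ9dG klEngGeo14 P R).CR := by
    refine le_trans ?_ (rowC_hQCR klEngGeo14 P R)
    have : (2 : ℝ) ^ 60 ≤ 2 ^ 60 * (klEngPsq P ^ 2 * klEngRsq R ^ 2) := le_mul_of_one_le_right (by positivity) hPR
    exact this.trans_eq (by ring)
  have hslot : 0 ≤ klEngGeo11.cloc * (P.Klam * U) ^ 2 * (4 : ℝ) ^ (-(klEngGeo11.θ * n)) := by
    have h4 : 0 < (4 : ℝ) ^ (-(klEngGeo11.θ * n)) := Real.rpow_pos_of_pos (by norm_num) _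
    rw [klEngGeo11_cloc_eq]; positivity
  have hmain := shareEps_arith (a := 2048 * 15367) (b := 4096 * 15381) (pow_nonneg hKU 3) (by positivity : (0 : ℝ) ≤ ((2 : ℝ) ^ n)⁻¹)
    (by norm_num) (by norm_num) (by norm_num) (by norm_num) hε₁ hεS hW hCR hslot
  have e : 2 * ((ε₁ * (2048 * 15367) + A₂ * (4096 * 15381) * (ρw / π + ((L : ℝ))⁻¹))) + 2 * (εS * (2048 * 15367)) =
      2 * (ε₁ * (2048 * 15367) + A₂ * (ρw / π + ((L : ℝ))⁻¹) * (4096 * 15381)) + 2 * (εS * (2048 * 15367)) := by ring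
  rw [e]
  exact hmain

/-! ## §3 (append, g25) The frame-shift ROOM line of the (c)-OUT package from currency sizes -/

/-- **THE FRAME-SHIFT ROOM LINE FROM CURRENCY SIZES**: the arithmetic row `547400·((8/π)·2946·n₆ + 4·s₂·n₄) ≤ klHshiftC` of the frame-shift sub-package of
`rowC_hexOut_of_pkgγ/δ` (the room line of p2's `hshift_succ_of_sizes_geom`) holds for ANY kernel sizes `n₆ ≤ 2⁶⁰`, `s₂·n₄ ≤ 2⁷⁰` (`klHshiftC = 2⁹⁶`;
`547400·(7503·2⁶⁰ + 4·2⁷⁰) ≈ 2^92.6`). -/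
theorem rowC_hshiftRoom_of_currency {n₆ s₂ n₄ : ℝ} (h6 : n₆ ≤ 2 ^ 60) (h24 : s₂ * n₄ ≤ 2 ^ 70) :
    547400 * (8 / Real.pi * 2946 * n₆ + 4 * s₂ * n₄) ≤ klHshiftC := by
  rw [klHshiftC_eq]
  have hπ3 := Real.pi_gt_three
  have hπ0 := Real.pi_pos
  have h8 : 8 / Real.pi ≤ 8 / 3 := div_le_div_of_nonneg_left (by norm_num) (by norm_num) hπ3.le
  have h80 : 0 ≤ 8 / Real.pi := by positivity
  rcases le_or_gt 0 n₆ with hn | hn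
  · have h1 : 8 / Real.pi * 2946 * n₆ ≤ 8 / 3 * 2946 * 2 ^ 60 := by
      have := mul_le_mul h8 (mul_le_mul_of_nonneg_left h6 (by norm_num : (0:ℝ) ≤ 2946)) (by positivity) (by norm_num)
      nlinarith
    nlinarith
  · have h1 : 8 / Real.pi * 2946 * n₆ ≤ 0 := by
      have : 0 ≤ 8 / Real.pi * 2946 := by positivity
      nlinarith
    nlinarith

end

end Summit.HubbardSuperconductivity.HubbardSuperconductivity.Theorems.EngineV8
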